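import Mathlib
import Summits.NavierStokesRegularity.NavierStokesRegularity.Theses.ReynoldsMonotone
import Summits.NavierStokesRegularity.NavierStokesRegularity.Theorems.TypeICertificateLadderStretchingRateThresholdOneViscosity
import Literature.Analysis.FluidPDE.ClassicalSolutionRescale
import Literature.Analysis.FluidPDE.NSLerayHopfABCScaling
import HarnessLib

/-!
# `ReynoldsMonotone.RayScaling` — the scaling dictionary along the viscosity ray
  (route `ReynoldsMonotone`, item stmt-NavierStokesRegularity-10429, support, card P1)

**Statement.** `(s, y) ↦ a·v(a s, y)` carries a BKM-class classical Leray–Hopf solution of `NS_ν`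
on `[0, T']`, `T' > T`, from `u₀` to one of `NS_{aν}` on `[0, T'/a]`, `T'/a > T/a`, from `a u₀`.

PROOF. The tree's `IsClassicalNSSolutionOn.stRescale` (α = a, γ = 1, β = a), `IsLerayHopfOn.viscosityRescale`
and `hasBoundedSobolevNormsOn_timeRescale`.

HONEST FRAMING: pure scaling bookkeeping; nothing here bears on the regularity problem itself.
-/

noncomputable section

set_option linter.dupNamespace false

namespace Summit.NavierStokesRegularity.NavierStokesRegularity.Theorems

open Set
open scoped ENNReal NNReal
open Literature.Analysis Literature.Analysis.FluidPDE

/-- **Item stmt-NavierStokesRegularity-10429** (`ReynoldsMonotone.RayScaling`). [this file; Tao2011 fn. 3] -/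
theorem reynoldsMonotone_rayScaling_proof :
    Summit.NavierStokesRegularity.NavierStokesRegularity.Theses.ReynoldsMonotone.RayScaling := by
  unfold Summit.NavierStokesRegularity.NavierStokesRegularity.Theses.ReynoldsMonotone.RayScaling
  rintro a ν T ha hν hT u₀ ⟨T', hTT', v, q, hcl, hB, hLH, hv0⟩
  have ha0 : a ≠ 0 := ha.ne'
  refine ⟨T' / a, div_lt_div_of_pos_right hTT' ha, timeRescale a a v, timeRescale a (a ^ 2) q,
    ?_, ?_, ?_, ?_⟩
  · -- classical at viscosity `aν` on `[0, T'/a]`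
    have key := hcl.stRescale ha one_pos (by rw [mul_one]) 0 0
    have hset : ((fun r => (0 : ℝ) + a * r) ⁻¹' Icc 0 T') = Icc 0 (T' / a) := by
      ext r
      simp only [mem_preimage, zero_add, mem_Icc]
      rw [le_div_iff₀ ha, mul_comm r a]
      constructor
      · rintro ⟨h0, h1⟩
        exact ⟨by nlinarith [h0, ha], h1⟩
      · rintro ⟨h0, h1⟩
        exact ⟨by positivity, h1⟩
    have hvel : a • stPull a 1 0 (0 : EuclideanSpace ℝ (Fin 3)) v = timeRescale a a v := by
      funext s y
      simp [stPull_apply, timeRescale_apply]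
    have hpr : (a ^ 2) • stPull a 1 0 (0 : EuclideanSpace ℝ (Fin 3)) q = timeRescale a (a ^ 2) q := by
      funext s y
      simp [stPull_apply, timeRescale_apply]
    rw [hset, smul_stPull_zero, hvel, hpr, show a * ν / 1 = a * ν by simp] at key
    exact key
  · -- BKM class
    have hB' : HasBoundedSobolevNormsOn (Icc 0 T') v := hB
    have hsm : ∀ t ∈ Icc 0 T', ContDiff ℝ (⊤ : ℕ∞) (v t) := fun t ht => hcl.contDiff_velocity ht
    have hmaps : MapsTo (fun s => a * s) (Icc 0 (T' / a)) (Icc 0 T') := by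
      intro s hs
      refine ⟨mul_nonneg ha.le hs.1, ?_⟩
      have := hs.2
      rw [le_div_iff₀ ha] at this
      linarith [mul_comm a s]
    exact hasBoundedSobolevNormsOn_timeRescale hB' hsm a a hmaps
  · -- Leray–Hopf
    have h := hLH.viscosityRescale ha
    rwa [timeRescale_zero_force] at h
  · -- datum
    funext y
    rw [timeRescale_apply, mul_zero, hv0, Pi.smul_apply]

end Summit.NavierStokesRegularity.NavierStokesRegularity.Theorems

end
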